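import Summits.BirchSwinnertonDyer.BirchSwinnertonDyer.Theorems.GenusKolyvaginAtTwoMinimalTwinBSDTwoRouteLedgerLine25EggSilent
import Summits.BirchSwinnertonDyer.BirchSwinnertonDyer.Theorems.GenusKolyvaginAtTwoMinimalTwinBSDTwoTranspositionDoor
import Summits.BirchSwinnertonDyer.BirchSwinnertonDyer.Theorems.GenusKolyvaginAtTwoMinimalTwinBSDTwoIdLocusBridge
import Summits.BirchSwinnertonDyer.BirchSwinnertonDyer.Theorems.GenusKolyvaginAtTwoGenusPrimitiveSupplyAtTwoHeegnerNonTorsionOfGZ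
import Summits.BirchSwinnertonDyer.Rank1Residual.AdditivePotMult.TwistSupply
import Literature.NumberTheory.EllipticCurves.AnalyticRankOrderProofs
import HarnessLib

/-!
# Route `GenusKolyvaginAtTwo` (rev 57–59), crux U₂ `MinimalTwinBSDTwo` (stmt-BirchSwinnertonDyer-22985): THE REVERSED SUPPLIES IN
# ANALYTIC FORM — on both consumed cells the Heegner-twin supply is «a prime `ℓ` in an explicit Čebotarev-type set with
# `L(W^{(−ℓ)}, 1) ≠ 0`» ∧ «the exact 2-adic exponent of `y_K`», everything else (non-torsion, Selmer clause, silence, the model) being PRINT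

Seat `bsd-line-gk2-p3` g29 (PROVER seat 3/3, cell `bsd-f1-sign2`), `--supports stmt-BirchSwinnertonDyer-22985` (helper; closes nothing).
THEOREMS ONLY (no definition, no named fact, no `sorry`); standard axioms.  **BSD is NOT proved by this file; U₂ / the wall / the supplies are
NOT proved; no item is closed.**  §1 is CONDITIONAL on Gross–Zagier for the pair and on `hasEntireLFunction_rat` (both statement-only PRINT
binders the U₂ ledgers already carry); §2–§3 are CONDITIONAL on the displayed hypotheses exactly like this seat's ledgers p768862
(`…RouteLedgerLine25Supplies`), p770637 (`…RouteLedgerLine25EggSilent`) and p770370 (`…TranspositionDoor`), which they re-type.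

THE POINT (planner currency).  The reversed supplies S2″₀ (egg cell, p770637) and S2⁻′ (`Δ < 0` cell, p768862) posit, besides a Heegner field
and the EXPONENT clause, (a) `P(1) = y_K` of infinite order, (b) a globally minimal model of the twin with (c) `#Sel₂ = 1` (resp. silence).
All of (a)–(c) are PRINT or Čebotarev once the field is `ℚ(√−ℓ)`:
* (a) ⟸ `L(W^{(−ℓ)}, 1) ≠ 0`: with `r_an(W) = 1` and both `L`-functions entire, `ord_{s=1} L(W/K, s) = 1 + 0`, so `L'(W/K,1) ≠ 0` and the
  Heegner point is non-torsion by Gross–Zagier (§1, the rank-one mirror of gk2-p4's `not_isOfFinAddOrder_derivedPoint_one_of_grossZagier`;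
  same argument as the CM seat's `CMSupply.not_isOfFinAddOrder_derivedPoint_one_of_rankOne`, here on the binder `hasEntireLFunction_rat`);
* (b) is free (`AdditivePotMult.exists_globallyMinimal_model_twist`, Silverman VIII.8.3);
* (c) on `Δ < 0`: `#Sel₂(Wd) = 1 ⟸` «`Sel₂(W)` not strict at `ℓ`» (this seat's `Door.natCard_selmerGroup_twin_eq_one_of_not_strict`, p770370,
  UNCONDITIONAL, `ℓ ≡ 7 (8)`) — a local condition on `Frob_ℓ` in `ℚ(W[2], ½P)`; on `Δ > 0` (egg): silence ⟸ «cubic rootless mod `ℓ`»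
  (`Silent.padicValNat_two_tamagawaProduct_twin_eq_of_discr_eq_neg_prime_of_noRoot`, p767915) and then the Selmer clause is automatic (p769884).
Hence the ANALYTIC supplies
  S2⁻ᵃ (`Δ < 0`, `ord₂ C = 1`): a prime `ℓ ≡ 7 (8)` with `−ℓ` Heegner for `N_W`, `Sel₂(W) ⊄ strictLocalKer_ℓ`, **`L(W^{(−ℓ)},1) ≠ 0`**, and a
        datum with **`2^{ord₂ c + 1} ∥ P(1)`**;
  S2⁺ᵃ (`Δ > 0`, `C` odd, `S₃`, egg): a prime `ℓ` with `−ℓ` Heegner for `N_W` (`ℓ ≠ 3`), cubic rootless mod `ℓ`, **`L(W^{(−ℓ)},1) ≠ 0`**, and a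
        datum with **`2^{ord₂ c} ∥ P(1)`**
imply S2⁻′ resp. S2″₀ pointwise (§2, §3), and therefore feed the cells: **hTw1 ⟸ S1⁻ + S2⁻ᵃ + PRINT**, **hTw0^{egg,S₃} ⟸ S1⁺ + S2⁺ᵃ + PRINT**.
READING: the beyond-print content of U₂ on the consumed cells is exactly (i) a SIMULTANEOUS Čebotarev / non-vanishing statement for prime
quadratic twists (literature: Ono–Skinner 1998, Ono 2001 Thm. 1 give prime twists with `L ≠ 0` in THEIR Frobenius class — compatibility with the
classes above is a placement question, acq-06572) and (ii) the 2-adic exponent of the Heegner point (= the BSD₂ content, lossless by p766364 /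
`OneBit.twoDivExponent_eq_padicValNat_tamagawa_of_bsdp`).  Nothing here is progress on BSD.

* §1 `not_isOfFinAddOrder_derivedPoint_one_of_rankOne_of_lValue_ne_zero` (mod GZ-pair + `hasEntireLFunction_rat`).
* §2 `reversedSupplyDepthOnePrime_of_analyticDoorSupply_of_facts` (S2⁻ᵃ ⟹ S2⁻′) and `hTw1_of_slicedWall_of_analyticDoorSupply_of_facts`.
* §3 `reversedSilentSupplyEgg_of_analyticSilentSupply_of_facts` (S2⁺ᵃ ⟹ S2″₀) and `hTw0eggS_of_slicedWall_of_analyticSilentSupply_of_facts`.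
* §4 `nonCMAtTwo_of_items_of_slicedWall_of_analyticSupplies_of_idLocus_line25` — `closes` (rev 57) ⟸ items + S1⁺ + S1⁻ + S2⁺ᵃ + S2⁻ᵃ + `S_id`
  (stmt-BirchSwinnertonDyer-32821 `RankOneAtTwoBigImageIdLocus`, signature verbatim) + PRINT, on this seat's ♯-sliced `closes` (p772295 §3).
  NET: **U₂|`closes` ⟸ WALL(2 cells) + «Čebotarev prime ℓ with L(W^{(−ℓ)},1) ≠ 0» + «2-adic exponent of y_K» + S_id + PRINT.**

References: [GrossZagier1986] Thm. I.6.3, V.§2, I.§7; [GrossLMS1991] §1 (1.1), §4; [MazurRubin2010] Lemma 2.11, Prop. 3.3, Cor. 3.4 (i);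
[Kramer1981] §2 Props. 3, 6; [OnoSkinner1998]; [Ono2001Crelle] Thm. 1, Cor. 3; [SilvermanAEC2009] VIII.8.3, X.4.2; [Miller2011LMS] Def. 1.1.
-/

set_option autoImplicit false
set_option linter.dupNamespace false -- `Summit.<P>.<Sub>` repeats `BirchSwinnertonDyer` (D-0017)

noncomputable section

open scoped Classical

open WeierstrassCurve NumberField Literature.NumberTheory.EllipticCurves
  Literature.NumberTheory.EllipticCurves.ModularForms
  Literature.NumberTheory.EllipticCurves.Rank1Residual
  Literature.NumberTheory.EllipticCurves.Rank1Residual.Typed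
  Literature.NumberTheory.EllipticCurves.KrizLi2019
  Summit.BirchSwinnertonDyer.Rank1Residual
  Summit.BirchSwinnertonDyer.Rank1Residual.AdditivePotMult
  Summit.BirchSwinnertonDyer.Rank1Residual.F1Sign2
  Summit.BirchSwinnertonDyer.BirchSwinnertonDyer.Rank1Residual
  Summit.BirchSwinnertonDyer.BirchSwinnertonDyer.Theses.GenusKolyvaginAtTwo
  Summit.BirchSwinnertonDyer.BirchSwinnertonDyer.Theorems.CMExactDescent
  Summit.BirchSwinnertonDyer.BirchSwinnertonDyer.Theorems.GenusExact.TwinSwap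
  Summit.BirchSwinnertonDyer.BirchSwinnertonDyer.Theorems.GenusExact.TwinSwap.OneBit
  Summit.BirchSwinnertonDyer.BirchSwinnertonDyer.Theorems.GenusExact.PlusDescent

namespace Summit.BirchSwinnertonDyer.BirchSwinnertonDyer.Theorems.GenusExact.TwinSwap.Ledger.Line25

/-! ## §1 `y_K` of infinite order for the rank-one member from `L(W^{(d_K)}, 1) ≠ 0` (mod Gross–Zagier + entire `L`) -/

/-- **`P(1) = y_K` has infinite order when `r_an(W) = 1` and `L(W^{(d_K)}, 1) ≠ 0`** (mod the Gross–Zagier formula for the pair and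
`hasEntireLFunction_rat`).  `ord_{s=1} L(W/K,s) = r_an(W) + r_an(W^{(d_K)}) = 1 + 0` (gk2-p4's per-pair additivity
`GenusKoly.analyticRankEK_eq_add_of_hasEntireLFunction`; `r_an(W^{(d_K)}) = 0 ⟺ L(W^{(d_K)},1) ≠ 0` for an entire `L`-function,
`analyticRank_eq_zero_iff_holds`), so `L'(W/K,1) ≠ 0`; the Heegner point `P₀ ∈ W(K)` under `P(1)` (PROVED descent at conductor `1` with
Shimura reciprocity) has infinite order by Gross–Zagier, and `W(K) → W(K[1])` is injective.  The rank-one mirror of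
`GenusKoly.not_isOfFinAddOrder_derivedPoint_one_of_grossZagier`; cf. `CMSupply.not_isOfFinAddOrder_derivedPoint_one_of_rankOne` (binder
`exists_isNewformOf` there, `hasEntireLFunction_rat` here — the PRINT binder the U₂ ledgers carry).
[cite: GrossZagier1986, Thm. I.6.3 with V.§2 and I.§7] [cite: GrossLMS1991, §1 (1.1) and §4 (P_1 = y_K)] -/
theorem not_isOfFinAddOrder_derivedPoint_one_of_rankOne_of_lValue_ne_zero (hmod : hasEntireLFunction_rat)
    (W : WeierstrassCurve ℚ) [W.IsElliptic] [NeZero (W.conductorNorm ℤ)]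
    (K : Type) [Field K] [NumberField K] (hGZ : gross_zagier (W.conductorNorm ℤ) W K)
    (hK : IsImaginaryQuadratic K) (hH : SatisfiesHeegnerHypothesis (W.conductorNorm ℤ) K)
    (hr1 : W.analyticRank = 1) (hL : (W.quadraticTwist (NumberField.discr K : ℚ)).entireLFunction 1 ≠ 0)
    {Dt : ModularParametrizationData W (W.conductorNorm ℤ)} {β : ℤ} {ι : K →+* ℂ}
    (d₁ : KolyvaginHeegnerData Dt β ι 1) : ¬ IsOfFinAddOrder d₁.derivedPoint := by
  have hd : (NumberField.discr K : ℚ) ≠ 0 := by exact_mod_cast NumberField.discr_ne_zero K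
  haveI := W.isElliptic_quadraticTwist hd
  have h0 : (W.quadraticTwist (NumberField.discr K : ℚ)).analyticRank = 0 :=
    ((W.quadraticTwist (NumberField.discr K : ℚ)).analyticRank_eq_zero_iff_holds (hmod _)).mpr hL
  have hEK : analyticRankEK W K = 1 := by
    rw [GenusKoly.analyticRankEK_eq_add_of_hasEntireLFunction W K (hmod W) (hmod _), hr1, h0]
  have hLd : LDerivEK W K ≠ 0 := LDerivEK_ne_zero_of_analyticRankEK_eq_one W K hEK
  obtain ⟨P₀, hP₀, hmap⟩ := heegnerSystem_exists_isHeegnerPoint_map_eq_derivedPoint_one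
    (heegnerPointOfConductor_one_galoisConj_holds (W.conductorNorm ℤ) W K) hK hH d₁
  have hP₀inf : ¬ IsOfFinAddOrder P₀ :=
    (lDerivEK_ne_zero_iff_not_isOfFinAddOrder W (W.conductorNorm ℤ) K hGZ hK hH hP₀).mp hLd
  intro hfin
  apply hP₀inf
  rw [← hmap] at hfin
  exact (WeierstrassCurve.Affine.Point.map_injective (W' := W) _).isOfFinAddOrder_iff.mp hfin

/-! ## §2 The `Δ < 0` cell: the analytic DOOR supply S2⁻ᵃ gives S2⁻′, hence hTw1 -/

/-- **S2⁻ᵃ ⟹ S2⁻′ pointwise** (mod GZ + `hasEntireLFunction_rat`).  S2⁻ᵃ (binder `hS2na`): for `W` non-CM globally minimal, `r_an = 1`,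
`#Sel₂ = 2`, `Δ < 0`, `ord₂ C(W) = 1` — an imaginary quadratic `K = ℚ(√−ℓ)`, `ℓ` prime (as a `Fact`, for `ℚ_ℓ`), `d_K = −ℓ` odd `≠ −3`, Heegner for `N_W`,
`2` SPLIT (`ℓ ≡ 7 (8)`), with **`Sel₂(W) ⊄ strictLocalKer_ℓ`** (door open: a Čebotarev condition on `ℓ`) and **`L(W^{(d_K)},1) ≠ 0`**, and a datum
`(Dt, β, ι, d₁)`, `c ≠ 0`, with the EXPONENT clause `2^{ord₂ c + 1} ∣ P(1)`, `2^{ord₂ c + 2} ∤ P(1)`.  CONCLUSION: the text of S2⁻′ (p768862's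
`hS2p`, verbatim) for that `W` — non-torsion by §1, the globally minimal model by Silverman VIII.8.3, `#Sel₂(Wd) = 1` by the door (p770370 §1,
unconditional).  CONDITIONAL on the displayed hypotheses; proves nothing about BSD; closes nothing.
[cite: MazurRubin2010, Lemma 2.11, Prop. 3.3, Cor. 3.4 (i)] [cite: GrossZagier1986, Thm. I.6.3 with V.§2] [cite: SilvermanAEC2009, VIII.8.3] -/
theorem reversedSupplyDepthOnePrime_of_analyticDoorSupply_of_facts
    (hGZ : ∀ (N : ℕ) [NeZero N] (W : WeierstrassCurve ℚ) (K : Type) [Field K] [NumberField K], gross_zagier N W K)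
    (hmod : hasEntireLFunction_rat)
    (hS2na : ∀ (W : WeierstrassCurve ℚ) [W.IsElliptic] [W.IsGloballyMinimal] [NeZero (W.conductorNorm ℤ)],
      ¬ W.HasCM → W.analyticRank = 1 → Nat.card (W.selmerGroup 2) = 2 → W.Δ < 0 → padicValNat 2 W.tamagawaProduct = 1 →
      ∃ (K : Type) (_ : Field K) (_ : NumberField K),
        IsImaginaryQuadratic K ∧
        (∃ (ℓ : ℕ) (_ : Fact ℓ.Prime), NumberField.discr K = -(ℓ : ℤ) ∧
          ¬ W.selmerGroup 2 ≤ MazurRubin2010.strictLocalKer W ℚ_[ℓ] 2) ∧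
        Odd (NumberField.discr K) ∧ NumberField.discr K ≠ -3 ∧ SatisfiesHeegnerHypothesis (W.conductorNorm ℤ) K ∧
        ((Ideal.span {(2 : ℤ)}).primesOver (𝓞 K)).ncard = 2 ∧
        (W.quadraticTwist (NumberField.discr K : ℚ)).entireLFunction 1 ≠ 0 ∧
        ∃ (Dt : ModularParametrizationData W (W.conductorNorm ℤ)) (β : ℤ) (ι : K →+* ℂ) (d₁ : KolyvaginHeegnerData Dt β ι 1),
          Dt.c ≠ 0 ∧
          (∃ Q : (W.baseChange (ringClassField K ι 1)).toAffine.Point,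
            ((2 ^ (padicValInt 2 Dt.c + 1) : ℕ) : ℤ) • Q = d₁.derivedPoint) ∧
          (¬ ∃ Q : (W.baseChange (ringClassField K ι 1)).toAffine.Point,
            ((2 ^ (padicValInt 2 Dt.c + 1 + 1) : ℕ) : ℤ) • Q = d₁.derivedPoint)) :
    ∀ (W : WeierstrassCurve ℚ) [W.IsElliptic] [W.IsGloballyMinimal] [NeZero (W.conductorNorm ℤ)],
      ¬ W.HasCM → W.analyticRank = 1 → Nat.card (W.selmerGroup 2) = 2 → W.Δ < 0 → padicValNat 2 W.tamagawaProduct = 1 →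
      ∃ (K : Type) (_ : Field K) (_ : NumberField K),
        IsImaginaryQuadratic K ∧ (∃ ℓ : ℕ, ℓ.Prime ∧ NumberField.discr K = -(ℓ : ℤ)) ∧ Odd (NumberField.discr K) ∧
        NumberField.discr K ≠ -3 ∧ SatisfiesHeegnerHypothesis (W.conductorNorm ℤ) K ∧
        ∃ (Dt : ModularParametrizationData W (W.conductorNorm ℤ)) (β : ℤ) (ι : K →+* ℂ) (d₁ : KolyvaginHeegnerData Dt β ι 1),
          Dt.c ≠ 0 ∧ ¬ IsOfFinAddOrder d₁.derivedPoint ∧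
          (∃ Q : (W.baseChange (ringClassField K ι 1)).toAffine.Point,
            ((2 ^ (padicValInt 2 Dt.c + 1) : ℕ) : ℤ) • Q = d₁.derivedPoint) ∧
          (¬ ∃ Q : (W.baseChange (ringClassField K ι 1)).toAffine.Point,
            ((2 ^ (padicValInt 2 Dt.c + 1 + 1) : ℕ) : ℤ) • Q = d₁.derivedPoint) ∧
          ∃ (Wd : WeierstrassCurve ℚ) (_ : Wd.IsElliptic) (_ : Wd.IsGloballyMinimal),
            (∃ C : WeierstrassCurve.VariableChange ℚ, C • W.quadraticTwist (NumberField.discr K : ℚ) = Wd) ∧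
            Nat.card (Wd.selmerGroup 2) = 1 := by
  intro W _ _ _ hcm hr hSel hΔ hC1
  obtain ⟨K, iF, iN, hK, ⟨ℓ, iℓ, hd, hns⟩, hodd, h3, hH, h2K, hL, Dt, β, ι, d₁, hc0, hdiv, hndiv⟩ := hS2na W hcm hr hSel hΔ hC1
  have hℓ : ℓ.Prime := iℓ.out
  have hD0 : (NumberField.discr K : ℚ) ≠ 0 := by exact_mod_cast NumberField.discr_ne_zero K
  -- (a) non-torsion from the `L`-value (§1)
  have hy : ¬ IsOfFinAddOrder d₁.derivedPoint :=
    not_isOfFinAddOrder_derivedPoint_one_of_rankOne_of_lValue_ne_zero hmod W K (hGZ _ W K) hK hH hr hL d₁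
  -- (b) a globally minimal model of the twin
  obtain ⟨Wd, iE, iM, Cd, hCd⟩ := exists_globallyMinimal_model_twist W hD0
  -- (c) `#Sel₂(Wd) = 1` by the door (unconditional DOWN)
  have hSel1 : Nat.card (Wd.selmerGroup 2) = 1 :=
    Door.natCard_selmerGroup_twin_eq_one_of_not_strict W hΔ hSel hK hodd hH h2K hd Wd ⟨Cd, hCd⟩ hns
  exact ⟨K, iF, iN, hK, ⟨ℓ, hℓ, hd⟩, hodd, h3, hH, Dt, β, ι, d₁, hc0, hy, hdiv, hndiv, Wd, iE, iM, ⟨Cd, hCd⟩, hSel1⟩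

/-- **hTw1 ⟸ S1⁻ + S2⁻ᵃ + PRINT.**  The `Δ < 0` Tamagawa cell of U₂ (`BSD₂` for non-CM globally minimal `W` with `r_an = 1`, `#Sel₂ = 2`,
`Δ < 0`, `ord₂ C(W) = 1`) from the sliced wall S1⁻ (`r_an = 0`, `#Sel₂ = 1`, `Δ < 0`, `ord₂ C = 2`), the ANALYTIC DOOR supply S2⁻ᵃ and the four
PRINT facts — p768862's `hTw1_of_slicedWall_of_reversedSupplyDepthOnePrime_of_facts` ∘ `reversedSupplyDepthOnePrime_of_analyticDoorSupply_of_facts`.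
CONDITIONAL on the displayed hypotheses; proves nothing about BSD; closes nothing.
[cite: GrossZagier1986, V.§2 (2.2)] [cite: Milne1972ArithmeticAV, §1 Thm. 1] [cite: MazurRubin2010, Cor. 3.4 (i)] [cite: Miller2011LMS, Def. 1.1] -/
theorem hTw1_of_slicedWall_of_analyticDoorSupply_of_facts
    (hGZ : ∀ (N : ℕ) [NeZero N] (W : WeierstrassCurve ℚ) (K : Type) [Field K] [NumberField K], gross_zagier N W K)
    (hGZK : rank_eq_analyticRank_of_analyticRank_le_one) (hmod : hasEntireLFunction_rat)
    (hMilneC : Milne1972.bsdQuotient_baseChange_quadratic_anyModel)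
    (hS1neg : ∀ (W : WeierstrassCurve ℚ) [W.IsElliptic] [W.IsGloballyMinimal],
      ¬ W.HasCM → W.analyticRank = 0 → Nat.card (W.selmerGroup 2) = 1 → W.Δ < 0 → padicValNat 2 W.tamagawaProduct = 2 → BSDp W 2)
    (hS2na : ∀ (W : WeierstrassCurve ℚ) [W.IsElliptic] [W.IsGloballyMinimal] [NeZero (W.conductorNorm ℤ)],
      ¬ W.HasCM → W.analyticRank = 1 → Nat.card (W.selmerGroup 2) = 2 → W.Δ < 0 → padicValNat 2 W.tamagawaProduct = 1 →
      ∃ (K : Type) (_ : Field K) (_ : NumberField K),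
        IsImaginaryQuadratic K ∧
        (∃ (ℓ : ℕ) (_ : Fact ℓ.Prime), NumberField.discr K = -(ℓ : ℤ) ∧
          ¬ W.selmerGroup 2 ≤ MazurRubin2010.strictLocalKer W ℚ_[ℓ] 2) ∧
        Odd (NumberField.discr K) ∧ NumberField.discr K ≠ -3 ∧ SatisfiesHeegnerHypothesis (W.conductorNorm ℤ) K ∧
        ((Ideal.span {(2 : ℤ)}).primesOver (𝓞 K)).ncard = 2 ∧
        (W.quadraticTwist (NumberField.discr K : ℚ)).entireLFunction 1 ≠ 0 ∧
        ∃ (Dt : ModularParametrizationData W (W.conductorNorm ℤ)) (β : ℤ) (ι : K →+* ℂ) (d₁ : KolyvaginHeegnerData Dt β ι 1),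
          Dt.c ≠ 0 ∧
          (∃ Q : (W.baseChange (ringClassField K ι 1)).toAffine.Point,
            ((2 ^ (padicValInt 2 Dt.c + 1) : ℕ) : ℤ) • Q = d₁.derivedPoint) ∧
          (¬ ∃ Q : (W.baseChange (ringClassField K ι 1)).toAffine.Point,
            ((2 ^ (padicValInt 2 Dt.c + 1 + 1) : ℕ) : ℤ) • Q = d₁.derivedPoint)) :
    ∀ (W : WeierstrassCurve ℚ) [W.IsElliptic] [W.IsGloballyMinimal], ¬ W.HasCM → W.analyticRank = 1 →
      Nat.card (W.selmerGroup 2) = 2 → W.Δ < 0 → padicValNat 2 W.tamagawaProduct = 1 → BSDp W 2 :=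
  hTw1_of_slicedWall_of_reversedSupplyDepthOnePrime_of_facts hGZ hGZK hmod hMilneC hS1neg
    (reversedSupplyDepthOnePrime_of_analyticDoorSupply_of_facts hGZ hmod hS2na)

/-! ## §3 The egg cell: the analytic SILENT supply S2⁺ᵃ gives S2″₀, hence hTw0^{egg,S₃} -/

/-- **S2⁺ᵃ ⟹ S2″₀ pointwise** (mod GZ + `hasEntireLFunction_rat`).  S2⁺ᵃ (binder `hS2pa`): for `W` non-CM globally minimal, `r_an = 1`,
`#Sel₂ = 2`, `C(W)` odd, `ρ̄_{W,2}` onto, `0 < Δ`, MEETING THE EGG — an imaginary quadratic `K = ℚ(√−ℓ)`, `ℓ` prime, `d_K = −ℓ` odd `≠ −3`,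
Heegner for `N_W`, with the `2`-division cubic of the minimal model ROOTLESS mod `ℓ` (silent: a Čebotarev condition) and **`L(W^{(d_K)},1) ≠ 0`**,
and a datum `(Dt, β, ι, d₁)`, `c ≠ 0`, with the EXPONENT clause `2^{ord₂ c} ∥ P(1)`.  CONCLUSION: the text of S2″₀ (p770637's `hS2egg0`,
verbatim) for that `W` — non-torsion by §1, a globally minimal model of the twin (Silverman VIII.8.3), which is all-silent (`ord₂ C(Wd) =
ord₂ C(W) = 0`, p767915).  CONDITIONAL on the displayed hypotheses; proves nothing about BSD; closes nothing.
[cite: Kramer1981, §2 Prop. 3] [cite: GrossZagier1986, Thm. I.6.3 with V.§2] [cite: SilvermanAEC2009, VIII.8.3] -/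
theorem reversedSilentSupplyEgg_of_analyticSilentSupply_of_facts
    (hGZ : ∀ (N : ℕ) [NeZero N] (W : WeierstrassCurve ℚ) (K : Type) [Field K] [NumberField K], gross_zagier N W K)
    (hmod : hasEntireLFunction_rat)
    (hS2pa : ∀ (W : WeierstrassCurve ℚ) [W.IsElliptic] [W.IsGloballyMinimal] [NeZero (W.conductorNorm ℤ)],
      ¬ W.HasCM → W.analyticRank = 1 → Nat.card (W.selmerGroup 2) = 2 → Odd W.tamagawaProduct → W.HasSurjectiveModNGaloisRep 2 →
      0 < W.Δ → MeetsEgg W →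
      ∃ (K : Type) (_ : Field K) (_ : NumberField K),
        IsImaginaryQuadratic K ∧
        (∃ ℓ : ℕ, ℓ.Prime ∧ NumberField.discr K = -(ℓ : ℤ) ∧
          ∀ x : ZMod ℓ, 4 * x ^ 3 + ((integralModelInt W).b₂ : ZMod ℓ) * x ^ 2 +
            2 * ((integralModelInt W).b₄ : ZMod ℓ) * x + ((integralModelInt W).b₆ : ZMod ℓ) ≠ 0) ∧
        Odd (NumberField.discr K) ∧ NumberField.discr K ≠ -3 ∧ SatisfiesHeegnerHypothesis (W.conductorNorm ℤ) K ∧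
        (W.quadraticTwist (NumberField.discr K : ℚ)).entireLFunction 1 ≠ 0 ∧
        ∃ (Dt : ModularParametrizationData W (W.conductorNorm ℤ)) (β : ℤ) (ι : K →+* ℂ) (d₁ : KolyvaginHeegnerData Dt β ι 1),
          Dt.c ≠ 0 ∧
          (∃ M₀ : ℕ, padicValInt 2 Dt.c = M₀ ∧
            (∃ Q : (W.baseChange (ringClassField K ι 1)).toAffine.Point, ((2 ^ M₀ : ℕ) : ℤ) • Q = d₁.derivedPoint) ∧
            (¬ ∃ Q : (W.baseChange (ringClassField K ι 1)).toAffine.Point, ((2 ^ (M₀ + 1) : ℕ) : ℤ) • Q = d₁.derivedPoint))) :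
    ∀ (W : WeierstrassCurve ℚ) [W.IsElliptic] [W.IsGloballyMinimal] [NeZero (W.conductorNorm ℤ)],
      ¬ W.HasCM → W.analyticRank = 1 → Nat.card (W.selmerGroup 2) = 2 → Odd W.tamagawaProduct → W.HasSurjectiveModNGaloisRep 2 →
      0 < W.Δ → MeetsEgg W →
      ∃ (K : Type) (_ : Field K) (_ : NumberField K),
        IsImaginaryQuadratic K ∧ Odd (NumberField.discr K) ∧ NumberField.discr K ≠ -3 ∧ SatisfiesHeegnerHypothesis (W.conductorNorm ℤ) K ∧
        ∃ (Dt : ModularParametrizationData W (W.conductorNorm ℤ)) (β : ℤ) (ι : K →+* ℂ) (d₁ : KolyvaginHeegnerData Dt β ι 1),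
          Dt.c ≠ 0 ∧ ¬ IsOfFinAddOrder d₁.derivedPoint ∧
          (∃ M₀ : ℕ, padicValInt 2 Dt.c = M₀ ∧
            (∃ Q : (W.baseChange (ringClassField K ι 1)).toAffine.Point, ((2 ^ M₀ : ℕ) : ℤ) • Q = d₁.derivedPoint) ∧
            (¬ ∃ Q : (W.baseChange (ringClassField K ι 1)).toAffine.Point, ((2 ^ (M₀ + 1) : ℕ) : ℤ) • Q = d₁.derivedPoint)) ∧
          ∃ (Wd : WeierstrassCurve ℚ) (_ : Wd.IsElliptic) (_ : Wd.IsGloballyMinimal),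
            (∃ C : VariableChange ℚ, C • W.quadraticTwist (NumberField.discr K : ℚ) = Wd) ∧ padicValNat 2 Wd.tamagawaProduct = 0 := by
  intro W _ _ _ hcm hr hSel hT hsurj hΔ hegg
  obtain ⟨K, iF, iN, hK, ⟨ℓ, hℓ, hd, hnoRoot⟩, hodd, h3, hH, hL, Dt, β, ι, d₁, hc0, hexp⟩ := hS2pa W hcm hr hSel hT hsurj hΔ hegg
  have hD0 : (NumberField.discr K : ℚ) ≠ 0 := by exact_mod_cast NumberField.discr_ne_zero K
  -- (a) non-torsion from the `L`-value (§1)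
  have hy : ¬ IsOfFinAddOrder d₁.derivedPoint :=
    not_isOfFinAddOrder_derivedPoint_one_of_rankOne_of_lValue_ne_zero hmod W K (hGZ _ W K) hK hH hr hL d₁
  -- (b) a globally minimal model of the twin, (c) silent: `ord₂ C(Wd) = ord₂ C(W) = 0`
  obtain ⟨Wd, iE, iM, Cd, hCd⟩ := exists_globallyMinimal_model_twist W hD0
  have hC0 : padicValNat 2 W.tamagawaProduct = 0 :=
    padicValNat.eq_zero_of_not_dvd (Nat.two_dvd_ne_zero.mpr (Nat.odd_iff.mp hT))
  have hSil : padicValNat 2 Wd.tamagawaProduct = padicValNat 2 W.tamagawaProduct :=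
    Silent.padicValNat_two_tamagawaProduct_twin_eq_of_discr_eq_neg_prime_of_noRoot W hK hodd hH hℓ hd hnoRoot Cd hCd
  exact ⟨K, iF, iN, hK, hodd, h3, hH, Dt, β, ι, d₁, hc0, hy, hexp, Wd, iE, iM, ⟨Cd, hCd⟩, by rw [hSil, hC0]⟩

/-- **hTw0^{egg,S₃} ⟸ S1⁺ + S2⁺ᵃ + PRINT.**  The egg sub-cell of U₂ (`BSD₂` for non-CM globally minimal `W` with `r_an = 1`, `#Sel₂ = 2`,
`ρ̄_{W,2}` onto, `0 < Δ`, `ord₂ C(W) = 0`, `MeetsEgg W`) from the sliced wall S1⁺ (`r_an = 0`, `#Sel₂ = 1`, `Δ > 0`, `ord₂ C = 0`), the ANALYTIC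
SILENT supply S2⁺ᵃ and the four PRINT facts — p770637's `hTw0eggS_of_slicedWall_of_reversedSilentSupplyEgg_of_facts` ∘
`reversedSilentSupplyEgg_of_analyticSilentSupply_of_facts` (the Selmer clause being automatic on the egg, p769884).  CONDITIONAL on the displayed
hypotheses; proves nothing about BSD; closes nothing.
[cite: Kramer1981, §2 Props. 3, 6] [cite: MazurRubin2010, Cor. 3.4 (i)] [cite: GrossZagier1986, V.§2 (2.2)] [cite: Miller2011LMS, Def. 1.1] -/
theorem hTw0eggS_of_slicedWall_of_analyticSilentSupply_of_facts
    (hGZ : ∀ (N : ℕ) [NeZero N] (W : WeierstrassCurve ℚ) (K : Type) [Field K] [NumberField K], gross_zagier N W K)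
    (hGZK : rank_eq_analyticRank_of_analyticRank_le_one) (hmod : hasEntireLFunction_rat)
    (hMilneC : Milne1972.bsdQuotient_baseChange_quadratic_anyModel)
    (hS1pos : ∀ (W : WeierstrassCurve ℚ) [W.IsElliptic] [W.IsGloballyMinimal],
      ¬ W.HasCM → W.analyticRank = 0 → Nat.card (W.selmerGroup 2) = 1 → 0 < W.Δ → padicValNat 2 W.tamagawaProduct = 0 → BSDp W 2)
    (hS2pa : ∀ (W : WeierstrassCurve ℚ) [W.IsElliptic] [W.IsGloballyMinimal] [NeZero (W.conductorNorm ℤ)],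
      ¬ W.HasCM → W.analyticRank = 1 → Nat.card (W.selmerGroup 2) = 2 → Odd W.tamagawaProduct → W.HasSurjectiveModNGaloisRep 2 →
      0 < W.Δ → MeetsEgg W →
      ∃ (K : Type) (_ : Field K) (_ : NumberField K),
        IsImaginaryQuadratic K ∧
        (∃ ℓ : ℕ, ℓ.Prime ∧ NumberField.discr K = -(ℓ : ℤ) ∧
          ∀ x : ZMod ℓ, 4 * x ^ 3 + ((integralModelInt W).b₂ : ZMod ℓ) * x ^ 2 +
            2 * ((integralModelInt W).b₄ : ZMod ℓ) * x + ((integralModelInt W).b₆ : ZMod ℓ) ≠ 0) ∧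
        Odd (NumberField.discr K) ∧ NumberField.discr K ≠ -3 ∧ SatisfiesHeegnerHypothesis (W.conductorNorm ℤ) K ∧
        (W.quadraticTwist (NumberField.discr K : ℚ)).entireLFunction 1 ≠ 0 ∧
        ∃ (Dt : ModularParametrizationData W (W.conductorNorm ℤ)) (β : ℤ) (ι : K →+* ℂ) (d₁ : KolyvaginHeegnerData Dt β ι 1),
          Dt.c ≠ 0 ∧
          (∃ M₀ : ℕ, padicValInt 2 Dt.c = M₀ ∧
            (∃ Q : (W.baseChange (ringClassField K ι 1)).toAffine.Point, ((2 ^ M₀ : ℕ) : ℤ) • Q = d₁.derivedPoint) ∧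
            (¬ ∃ Q : (W.baseChange (ringClassField K ι 1)).toAffine.Point, ((2 ^ (M₀ + 1) : ℕ) : ℤ) • Q = d₁.derivedPoint))) :
    ∀ (W : WeierstrassCurve ℚ) [W.IsElliptic] [W.IsGloballyMinimal], ¬ W.HasCM → W.analyticRank = 1 →
      Nat.card (W.selmerGroup 2) = 2 → W.HasSurjectiveModNGaloisRep 2 → 0 < W.Δ → padicValNat 2 W.tamagawaProduct = 0 →
      MeetsEgg W → BSDp W 2 :=
  hTw0eggS_of_slicedWall_of_reversedSilentSupplyEgg_of_facts hGZ hGZK hmod hMilneC hS1pos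
    (reversedSilentSupplyEgg_of_analyticSilentSupply_of_facts hGZ hmod hS2pa)

/-! ## §4 The merged ledger with ANALYTIC supplies: U₂ ↦ «S1⁺ + S1⁻ + S2⁺ᵃ + S2⁻ᵃ + S_id» -/

/-- **THE ANALYTIC LEDGER ON REV 57: U₂|`closes` ⟸ S1⁺ + S1⁻ + S2⁺ᵃ + S2⁻ᵃ + `S_id` + PRINT.**  This seat's ♯-sliced `closes`
(`nonCMAtTwo_of_items_of_tamagawaSlicedSharpTwin_line25`, p772295: U₂ consumed only on the two Tamagawa cells of curves with surjective 2-adic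
image) with `hTw0♯` split on `MeetsEgg` — egg half by §3 (S1⁺ + S2⁺ᵃ + PRINT; `ρ̄_{W,2}` onto is level `1` of the tower), identity half by the
bridge `hTw0idSharp_of_idLocus_of_GZK` (p772295 §2) onto **`hSid`** = item stmt-BirchSwinnertonDyer-32821 `RankOneAtTwoBigImageIdLocus` (signature
VERBATIM) — and `hTw1♯` by §2 (S1⁻ + S2⁻ᵃ + PRINT).  Every other binder = the route's items as in `closes` (rev 57) and the four PRINT facts.
So the beyond-print content of U₂ inside the consumed cells is DISPLAYED as: the two-cell rank-zero wall, two «Čebotarev prime with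
`L(W^{(−ℓ)},1) ≠ 0» ∧ «exact 2-adic exponent of `y_K`» supplies, and the sibling route's `S_id`.  CONDITIONAL on the displayed hypotheses;
proves nothing about BSD by itself; closes no item.
[cite: GrossZagier1986, Thm. I.6.3, V.§2 (2.2)] [cite: MazurRubin2010, Cor. 3.4 (i), Prop. 3.3] [cite: Kramer1981, §2 Props. 3, 6]
[cite: DokchitserDokchitserMathZ2012, Theorem (1)–(3)] [cite: Miller2011LMS, Def. 1.1] -/
theorem nonCMAtTwo_of_items_of_slicedWall_of_analyticSupplies_of_idLocus_line25
    (hP : GenusPrimitiveSupplyAtTwoPosDiscShallow) (hPG : GenusDeepSupplyAtTwoNegDiscNarrow) (hQ1 : CyclicTorsionOfNegDisc)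
    (hQ2 : KolyvaginRelationAtTwo)
    (hQ5R : EquivariantChebotarevAtTwoR) (hQ3RT : EquivariantKolyvaginExactAtTwoRT)
    (hQ4T : KolyvaginExactAtTwoPosDiscT) (hGf : ExactDescentAtTwoOfFourFacts)
    (hR : OffHabitatResidualAtTwo) (hOff : OffCutResidualAtTwoR)
    (hK1P : K1Pos) (hK1N : K1Neg) (hSha1 : ShaVanishingAtDepthZeroAtTwo)
    (hS1pos : ∀ (W : WeierstrassCurve ℚ) [W.IsElliptic] [W.IsGloballyMinimal],
      ¬ W.HasCM → W.analyticRank = 0 → Nat.card (W.selmerGroup 2) = 1 → 0 < W.Δ → padicValNat 2 W.tamagawaProduct = 0 → BSDp W 2)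
    (hS1neg : ∀ (W : WeierstrassCurve ℚ) [W.IsElliptic] [W.IsGloballyMinimal],
      ¬ W.HasCM → W.analyticRank = 0 → Nat.card (W.selmerGroup 2) = 1 → W.Δ < 0 → padicValNat 2 W.tamagawaProduct = 2 → BSDp W 2)
    (hS2pa : ∀ (W : WeierstrassCurve ℚ) [W.IsElliptic] [W.IsGloballyMinimal] [NeZero (W.conductorNorm ℤ)],
      ¬ W.HasCM → W.analyticRank = 1 → Nat.card (W.selmerGroup 2) = 2 → Odd W.tamagawaProduct → W.HasSurjectiveModNGaloisRep 2 →
      0 < W.Δ → MeetsEgg W →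
      ∃ (K : Type) (_ : Field K) (_ : NumberField K),
        IsImaginaryQuadratic K ∧
        (∃ ℓ : ℕ, ℓ.Prime ∧ NumberField.discr K = -(ℓ : ℤ) ∧
          ∀ x : ZMod ℓ, 4 * x ^ 3 + ((integralModelInt W).b₂ : ZMod ℓ) * x ^ 2 +
            2 * ((integralModelInt W).b₄ : ZMod ℓ) * x + ((integralModelInt W).b₆ : ZMod ℓ) ≠ 0) ∧
        Odd (NumberField.discr K) ∧ NumberField.discr K ≠ -3 ∧ SatisfiesHeegnerHypothesis (W.conductorNorm ℤ) K ∧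
        (W.quadraticTwist (NumberField.discr K : ℚ)).entireLFunction 1 ≠ 0 ∧
        ∃ (Dt : ModularParametrizationData W (W.conductorNorm ℤ)) (β : ℤ) (ι : K →+* ℂ) (d₁ : KolyvaginHeegnerData Dt β ι 1),
          Dt.c ≠ 0 ∧
          (∃ M₀ : ℕ, padicValInt 2 Dt.c = M₀ ∧
            (∃ Q : (W.baseChange (ringClassField K ι 1)).toAffine.Point, ((2 ^ M₀ : ℕ) : ℤ) • Q = d₁.derivedPoint) ∧
            (¬ ∃ Q : (W.baseChange (ringClassField K ι 1)).toAffine.Point, ((2 ^ (M₀ + 1) : ℕ) : ℤ) • Q = d₁.derivedPoint)))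
    (hS2na : ∀ (W : WeierstrassCurve ℚ) [W.IsElliptic] [W.IsGloballyMinimal] [NeZero (W.conductorNorm ℤ)],
      ¬ W.HasCM → W.analyticRank = 1 → Nat.card (W.selmerGroup 2) = 2 → W.Δ < 0 → padicValNat 2 W.tamagawaProduct = 1 →
      ∃ (K : Type) (_ : Field K) (_ : NumberField K),
        IsImaginaryQuadratic K ∧
        (∃ (ℓ : ℕ) (_ : Fact ℓ.Prime), NumberField.discr K = -(ℓ : ℤ) ∧
          ¬ W.selmerGroup 2 ≤ MazurRubin2010.strictLocalKer W ℚ_[ℓ] 2) ∧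
        Odd (NumberField.discr K) ∧ NumberField.discr K ≠ -3 ∧ SatisfiesHeegnerHypothesis (W.conductorNorm ℤ) K ∧
        ((Ideal.span {(2 : ℤ)}).primesOver (𝓞 K)).ncard = 2 ∧
        (W.quadraticTwist (NumberField.discr K : ℚ)).entireLFunction 1 ≠ 0 ∧
        ∃ (Dt : ModularParametrizationData W (W.conductorNorm ℤ)) (β : ℤ) (ι : K →+* ℂ) (d₁ : KolyvaginHeegnerData Dt β ι 1),
          Dt.c ≠ 0 ∧
          (∃ Q : (W.baseChange (ringClassField K ι 1)).toAffine.Point,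
            ((2 ^ (padicValInt 2 Dt.c + 1) : ℕ) : ℤ) • Q = d₁.derivedPoint) ∧
          (¬ ∃ Q : (W.baseChange (ringClassField K ι 1)).toAffine.Point,
            ((2 ^ (padicValInt 2 Dt.c + 1 + 1) : ℕ) : ℤ) • Q = d₁.derivedPoint))
    (hSid : ∀ (W : WeierstrassCurve ℚ) [W.IsElliptic] [W.IsGloballyMinimal], ¬ W.HasCM →
      (∀ n : ℕ, W.HasSurjectiveModNGaloisRep ((2 ^ n : ℕ) : ℤ)) → W.analyticRank = 1 →
      (0 < W.Δ ∧ Summit.BirchSwinnertonDyer.Rank1Residual.F1Sign2.NoRationalTwoTorsion W ∧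
        Summit.BirchSwinnertonDyer.Rank1Residual.F1Sign2.ShaTwoTrivial W ∧
        ¬ Summit.BirchSwinnertonDyer.Rank1Residual.F1Sign2.MeetsEgg W ∧ ¬ 2 ∣ W.tamagawaProduct) →
      Literature.NumberTheory.EllipticCurves.BSDp W 2)
    (hL : EntireLFunctionRat)
    (hGZ : GrossZagierAllLevels) (hGZK : MultPublishedInputsAtTwo) (hMi : MilneAnyModel) :
    NonCMAtTwo :=
  nonCMAtTwo_of_items_of_tamagawaSlicedSharpTwin_line25 hP hPG hQ1 hQ2 hQ5R hQ3RT hQ4T hGf hR hOff hK1P hK1N hSha1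
    (fun W _ _ hcm hr hSel hρ hΔ hC0 ↦ by
      by_cases hegg : MeetsEgg W
      · exact hTw0eggS_of_slicedWall_of_analyticSilentSupply_of_facts hGZ hGZK hL hMi hS1pos hS2pa W hcm hr hSel
          (by simpa using hρ 1) hΔ hC0 hegg
      · exact hTw0idSharp_of_idLocus_of_GZK hGZK hSid W hcm hr hSel hρ hΔ hC0 hegg)
    (fun W _ _ hcm hr hSel _ hΔ hC1 ↦
      hTw1_of_slicedWall_of_analyticDoorSupply_of_facts hGZ hGZK hL hMi hS1neg hS2na W hcm hr hSel hΔ hC1)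
    hL hGZ hGZK hMi

end Summit.BirchSwinnertonDyer.BirchSwinnertonDyer.Theorems.GenusExact.TwinSwap.Ledger.Line25

end
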